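import Summits.NavierStokesRegularity.FluidComputer.PalasekTowerTinyBlob
import Literature.Analysis.FluidPDE.SpaceTimeMollifier
import Literature.Analysis.FluidPDE.SverakLandauConformalCalc

/-!
# The tiny blob, III: derivative, incompressibility, flatness at the centre, a strain point

Cell `ns-blowup`, seat `ns-blowup-ecbridge-4` (g3); GROUP C «BRIDGE SUPPORT» of the route
`PalasekTowerBreakdown` (crux `EpisodeBaseG`, item stmt-NavierStokesRegularity-19179; negative lane
`TinyAnchoredHosts`). Sequel of `PalasekTowerTinyBlob.lean`. LABEL: E–C typing (KERNEL calculus, one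
auxiliary definition `blobCoef` with body; everything proved). WHAT THIS IS NOT: not Navier–Stokes
evidence — vector calculus of one explicit field; no flow, stage or schedule.

* `hasFDerivAt_tinyBlob` — the Jacobian of `B_a = F(s) • e₃ − φ • id`, `s = ‖y‖²/a²`,
  `φ = y₂ G(s)/a²`: `DB(y)h = F′(s)(2/a²)⟪y,h⟫ e₃ − φ(y) h − (Dφ(y)h) y`;
* `isDivFree_tinyBlob` — `div B = (2/a²)F′(s) y₂ − 3φ − Dφ(y)y = (y₂/a²)(2F′ − 4G − 2sG′) = 0` by
  `F′ = 2G + sG′` (`hasDerivAt_blobF`);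
* `fderiv_tinyBlob_zero`, `laplacian_tinyBlob_zero` — FLATNESS at the centre (`F′(0) = 0`, `G(0) = 0`,
  `φ(0) = 0`, `Dφ(0) = 0`; radial Laplacian `Δ(F∘s)(0) = 6F′(0)/a²`, Leibniz for `φ · yⱼ`);
* `exists_fderiv_tinyBlob_ne_zero` — a nonconstant compactly supported field has a point with nonzero
  Jacobian, necessarily inside `B̄(0, 2a)` (outside, the field vanishes identically).

References: folklore vector calculus; serves S. Palasek, arXiv:2605.13827 §3.3 [cite: Palasek2026ElementaryModel, §3.3].
-/

noncomputable section

namespace Summit.NavierStokesRegularity.FluidComputer.PalasekTowerClayBridge.TinyBlob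

open Set Function Filter Topology InnerProductSpace Metric MeasureTheory
open scoped Topology ContDiff RealInnerProductSpace Laplacian

open Literature.Analysis.FluidPDE

variable {a : ℝ}

/-! ## §1 The scalar coefficient `φ = y₂ G(s)/a²` and the two Jacobians -/

/-- The coefficient `φ_a(y) = y₂ G(‖y‖²/a²) / a²` of the radial part of the blob. [folklore] -/
def blobCoef (a : ℝ) (y : EuclideanSpace ℝ (Fin 3)) : ℝ := y 2 * blobG (sqn a y) / a ^ 2

/-- The blob is `F(s) • e₃ − φ • id`. [folklore] -/
theorem tinyBlob_eq_coef (a : ℝ) (y : EuclideanSpace ℝ (Fin 3)) :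
    tinyBlob a y = blobF (sqn a y) • e₃ - blobCoef a y • y := rfl

/-- The third coordinate is the continuous linear form `proj 2`. [folklore] -/
theorem hasFDerivAt_coord_two (y : EuclideanSpace ℝ (Fin 3)) :
    HasFDerivAt (fun z : EuclideanSpace ℝ (Fin 3) => z 2)
      (EuclideanSpace.proj (2 : Fin 3) : EuclideanSpace ℝ (Fin 3) →L[ℝ] ℝ) y :=
  (EuclideanSpace.proj (2 : Fin 3) : EuclideanSpace ℝ (Fin 3) →L[ℝ] ℝ).hasFDerivAt

/-- **Jacobian of the `e₃`-coefficient**: `D(F∘s)(y) = F′(s) (2/a²)⟪y, ·⟫`, `F′ = 2G + sG′`. [folklore] -/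
theorem hasFDerivAt_blobF_sqn (a : ℝ) (y : EuclideanSpace ℝ (Fin 3)) :
    HasFDerivAt (fun z => blobF (sqn a z))
      ((2 * blobG (sqn a y) + sqn a y * deriv blobG (sqn a y)) • ((2 / a ^ 2) • innerSL ℝ y)) y :=
  (hasDerivAt_blobF (sqn a y)).comp_hasFDerivAt y (hasFDerivAt_sqn a y)

/-- **Jacobian of the radial coefficient** `φ = (a²)⁻¹ (y₂ · G∘s)`. [folklore] -/
theorem hasFDerivAt_blobCoef (a : ℝ) (y : EuclideanSpace ℝ (Fin 3)) :
    HasFDerivAt (blobCoef a)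
      ((a ^ 2)⁻¹ • (y 2 • (deriv blobG (sqn a y) • ((2 / a ^ 2) • innerSL ℝ y)) +
        blobG (sqn a y) • (EuclideanSpace.proj (2 : Fin 3) : EuclideanSpace ℝ (Fin 3) →L[ℝ] ℝ))) y := by
  have hG : HasFDerivAt (fun z => blobG (sqn a z)) (deriv blobG (sqn a y) • ((2 / a ^ 2) • innerSL ℝ y)) y :=
    ((contDiff_blobG.differentiable (by simp)) (sqn a y)).hasDerivAt.comp_hasFDerivAt y (hasFDerivAt_sqn a y)
  have hprod := (hasFDerivAt_coord_two y).mul hG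
  have h := hprod.const_mul (a ^ 2)⁻¹
  have hfun : blobCoef a = fun z : EuclideanSpace ℝ (Fin 3) => (a ^ 2)⁻¹ * (z 2 * blobG (sqn a z)) := by
    funext z; rw [blobCoef, div_eq_inv_mul]
  rw [hfun]
  exact h

/-- `φ` is smooth. [folklore] -/
theorem contDiff_blobCoef (a : ℝ) : ContDiff ℝ ∞ (blobCoef a) := by
  have h2 : ContDiff ℝ ∞ fun y : EuclideanSpace ℝ (Fin 3) => y 2 :=
    (EuclideanSpace.proj (2 : Fin 3) : EuclideanSpace ℝ (Fin 3) →L[ℝ] ℝ).contDiff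
  exact (h2.mul (contDiff_blobG.comp (contDiff_sqn a))).div_const _

/-- `φ(0) = 0`. [folklore] -/
theorem blobCoef_zero (a : ℝ) : blobCoef a 0 = 0 := by simp [blobCoef]

/-- `Dφ(0) = 0` (`G(0) = 0` and the product rule). [folklore] -/
theorem fderiv_blobCoef_zero (a : ℝ) : fderiv ℝ (blobCoef a) 0 = 0 := by
  rw [(hasFDerivAt_blobCoef a 0).fderiv, sqn_zero, blobG_zero]
  ext v
  simp

/-- **THE JACOBIAN OF THE BLOB.** [folklore] -/
theorem hasFDerivAt_tinyBlob (a : ℝ) (y : EuclideanSpace ℝ (Fin 3)) :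
    HasFDerivAt (tinyBlob a)
      (((2 * blobG (sqn a y) + sqn a y * deriv blobG (sqn a y)) • ((2 / a ^ 2) • innerSL ℝ y)).smulRight e₃ -
        (blobCoef a y • ContinuousLinearMap.id ℝ (EuclideanSpace ℝ (Fin 3)) +
          ((a ^ 2)⁻¹ • (y 2 • (deriv blobG (sqn a y) • ((2 / a ^ 2) • innerSL ℝ y)) +
            blobG (sqn a y) • (EuclideanSpace.proj (2 : Fin 3) : EuclideanSpace ℝ (Fin 3) →L[ℝ] ℝ))).smulRight y))
      y := by
  have h1 := (hasFDerivAt_blobF_sqn a y).smul_const e₃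
  have h2 := (hasFDerivAt_blobCoef a y).smul (hasFDerivAt_id y)
  exact h1.sub h2

/-- **`DB_a(0) = 0`.** [folklore] -/
theorem fderiv_tinyBlob_zero (a : ℝ) : fderiv ℝ (tinyBlob a) 0 = 0 := by
  rw [(hasFDerivAt_tinyBlob a 0).fderiv, sqn_zero, blobG_zero, blobCoef_zero]
  ext v i
  simp

/-! ## §2 Incompressibility -/

/-- **THE BLOB IS DIVERGENCE FREE**: `div B_a = (y₂/a²)(2F′ − 4G − 2sG′) = 0`. [folklore] -/
theorem isDivFree_tinyBlob (ha : a ≠ 0) : VectorCalculus.IsDivFree (tinyBlob a) := by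
  intro y
  set s := sqn a y with hs
  have hFd : DifferentiableAt ℝ (fun z => blobF (sqn a z)) y := (hasFDerivAt_blobF_sqn a y).differentiableAt
  have hφd : DifferentiableAt ℝ (blobCoef a) y := (hasFDerivAt_blobCoef a y).differentiableAt
  have hcd : DifferentiableAt ℝ (fun _ : EuclideanSpace ℝ (Fin 3) => e₃) y := differentiableAt_const _
  have hid : DifferentiableAt ℝ (fun z : EuclideanSpace ℝ (Fin 3) => z) y := differentiableAt_id
  have h1 : DifferentiableAt ℝ (fun z => blobF (sqn a z) • e₃) y := hFd.smul hcd
  have h2 : DifferentiableAt ℝ (fun z => blobCoef a z • z) y := hφd.smul hid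
  have hfun : tinyBlob a = fun z => blobF (sqn a z) • e₃ - blobCoef a z • z := rfl
  rw [hfun, divergence_sub_apply h1 h2, divergence_smul_apply hFd hcd, divergence_smul_apply hφd hid,
    Sverak2011.divergence_id_three]
  have hc0 : VectorCalculus.divergence (fun _ : EuclideanSpace ℝ (Fin 3) => e₃) y = 0 := by
    simp [VectorCalculus.divergence]
  rw [hc0, mul_zero, zero_add]
  -- the two gradients as directional derivatives
  have hg1 : ⟪e₃, gradient (fun z => blobF (sqn a z)) y⟫ = fderiv ℝ (fun z => blobF (sqn a z)) y e₃ := by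
    rw [gradient, real_inner_comm, InnerProductSpace.toDual_symm_apply]
  have hg2 : ⟪y, gradient (blobCoef a) y⟫ = fderiv ℝ (blobCoef a) y y := by
    rw [gradient, real_inner_comm, InnerProductSpace.toDual_symm_apply]
  have hyy : ⟪y, y⟫ = a ^ 2 * s := by
    rw [real_inner_self_eq_norm_sq, hs, sqn]; field_simp
  have e1 : fderiv ℝ (fun z => blobF (sqn a z)) y e₃ = (2 * blobG s + s * deriv blobG s) * (2 / a ^ 2 * y 2) := by
    rw [(hasFDerivAt_blobF_sqn a y).fderiv, ← hs]
    show (2 * blobG s + s * deriv blobG s) • ((2 / a ^ 2) • ⟪y, e₃⟫) = _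
    rw [inner_e₃_right, smul_eq_mul, smul_eq_mul]
  have e2 : fderiv ℝ (blobCoef a) y y =
      (a ^ 2)⁻¹ * (y 2 * (deriv blobG s * (2 / a ^ 2 * (a ^ 2 * s))) + blobG s * y 2) := by
    rw [(hasFDerivAt_blobCoef a y).fderiv, ← hs]
    show (a ^ 2)⁻¹ • (y 2 • (deriv blobG s • ((2 / a ^ 2) • ⟪y, y⟫)) + blobG s • y 2) = _
    rw [hyy]
    simp only [smul_eq_mul]
  have e3 : blobCoef a y = y 2 * blobG s / a ^ 2 := by rw [blobCoef, ← hs]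
  rw [hg1, hg2, e1, e2, e3]
  field_simp
  ring

/-! ## §3 Flatness at the centre: the Laplacian -/

/-- `Δ(F∘s)(0) = 6 F′(0)/a² = 0`. [folklore] -/
theorem laplacian_blobF_sqn_zero (a : ℝ) :
    (Δ (fun z : EuclideanSpace ℝ (Fin 3) => blobF (sqn a z))) 0 = 0 := by
  -- `g σ = F(σ/a²)`, `g₁ σ = F′(σ/a²)/a²`
  set g : ℝ → ℝ := fun σ => blobF (σ / a ^ 2) with hg
  set g₁ : ℝ → ℝ := fun σ => deriv blobF (σ / a ^ 2) / a ^ 2 with hg₁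
  have hFd : ∀ σ, HasDerivAt blobF (deriv blobF σ) σ := fun σ =>
    ((contDiff_blobF.differentiable (by simp)) σ).hasDerivAt
  have hgd : ∀ σ ∈ (univ : Set ℝ), HasDerivAt g (g₁ σ) σ := by
    intro σ _
    have h := (hFd (σ / a ^ 2)).comp σ ((hasDerivAt_id σ).div_const (a ^ 2))
    exact h.congr_deriv (by simp only [hg₁]; ring)
  have hF2 : Differentiable ℝ (deriv blobF) :=
    ((contDiff_infty_iff_deriv.1 contDiff_blobF).2).differentiable (by simp)
  have hg₁d : HasDerivAt g₁ (deriv (deriv blobF) (‖(0 : EuclideanSpace ℝ (Fin 3))‖ ^ 2 / a ^ 2) / a ^ 2 / a ^ 2)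
      (‖(0 : EuclideanSpace ℝ (Fin 3))‖ ^ 2) := by
    have h := ((hF2 _).hasDerivAt.comp (‖(0 : EuclideanSpace ℝ (Fin 3))‖ ^ 2)
      ((hasDerivAt_id (‖(0 : EuclideanSpace ℝ (Fin 3))‖ ^ 2)).div_const (a ^ 2))).div_const (a ^ 2)
    exact h.congr_deriv (by simp only [id_eq]; ring)
  have hfun : (fun z : EuclideanSpace ℝ (Fin 3) => blobF (sqn a z)) = fun z => g (‖z‖ ^ 2) := by
    funext z; simp [hg, sqn]
  rw [hfun, laplacian_comp_norm_sq isOpen_univ hgd (mem_univ _) hg₁d]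
  simp [hg₁, deriv_blobF_zero]

/-- `Δ(φ · yⱼ)(0) = 0` for each coordinate `j` (`φ(0) = 0`, `yⱼ(0) = 0`, `Dφ(0) = 0`). [folklore] -/
theorem laplacian_blobCoef_mul_coord_zero (a : ℝ) (j : Fin 3) :
    (Δ (fun z : EuclideanSpace ℝ (Fin 3) => blobCoef a z * z j)) 0 = 0 := by
  have hφ : ContDiff ℝ 2 (blobCoef a) := (contDiff_blobCoef a).of_le (by norm_cast)
  have hj : ContDiff ℝ 2 (fun z : EuclideanSpace ℝ (Fin 3) => z j) :=
    (EuclideanSpace.proj j : EuclideanSpace ℝ (Fin 3) →L[ℝ] ℝ).contDiff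
  rw [laplacian_mul_eq (EuclideanSpace.basisFun (Fin 3) ℝ) hφ hj 0, blobCoef_zero,
    fderiv_blobCoef_zero]
  simp

/-- The radial part as a sum over coordinates: `φ • y = Σⱼ (φ yⱼ) • eⱼ`. [folklore] -/
theorem blobCoef_smul_eq (a : ℝ) :
    (fun z : EuclideanSpace ℝ (Fin 3) => blobCoef a z • z) =
      (fun z => (blobCoef a z * z 0) • EuclideanSpace.single (0 : Fin 3) (1 : ℝ)) +
      ((fun z => (blobCoef a z * z 1) • EuclideanSpace.single (1 : Fin 3) (1 : ℝ)) +
       (fun z => (blobCoef a z * z 2) • EuclideanSpace.single (2 : Fin 3) (1 : ℝ))) := by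
  funext z
  ext i
  fin_cases i <;> simp

/-- `Δ(φ • id)(0) = 0`. [folklore] -/
theorem laplacian_blobCoef_smul_zero (a : ℝ) :
    (Δ (fun z : EuclideanSpace ℝ (Fin 3) => blobCoef a z • z)) 0 = 0 := by
  have hφ : ContDiff ℝ 2 (blobCoef a) := (contDiff_blobCoef a).of_le (by norm_cast)
  have hψ : ∀ j : Fin 3, ContDiff ℝ 2 (fun z : EuclideanSpace ℝ (Fin 3) => blobCoef a z * z j) := fun j =>
    hφ.mul (EuclideanSpace.proj j : EuclideanSpace ℝ (Fin 3) →L[ℝ] ℝ).contDiff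
  have hT : ∀ j : Fin 3, ContDiffAt ℝ 2
      (fun z : EuclideanSpace ℝ (Fin 3) => (blobCoef a z * z j) • EuclideanSpace.single j (1 : ℝ)) 0 :=
    fun j => ((hψ j).smul contDiff_const).contDiffAt
  have h12 : ContDiffAt ℝ 2
      ((fun z : EuclideanSpace ℝ (Fin 3) => (blobCoef a z * z 1) • EuclideanSpace.single (1 : Fin 3) (1 : ℝ)) +
        (fun z => (blobCoef a z * z 2) • EuclideanSpace.single (2 : Fin 3) (1 : ℝ))) 0 := (hT 1).add (hT 2)
  rw [blobCoef_smul_eq, (hT 0).laplacian_add h12, (hT 1).laplacian_add (hT 2),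
    laplacian_smul_const (θ := fun z : EuclideanSpace ℝ (Fin 3) => blobCoef a z * z 0) (hψ 0),
    laplacian_smul_const (θ := fun z : EuclideanSpace ℝ (Fin 3) => blobCoef a z * z 1) (hψ 1),
    laplacian_smul_const (θ := fun z : EuclideanSpace ℝ (Fin 3) => blobCoef a z * z 2) (hψ 2),
    laplacian_blobCoef_mul_coord_zero, laplacian_blobCoef_mul_coord_zero,
    laplacian_blobCoef_mul_coord_zero]
  simp

/-- **`ΔB_a(0) = 0`.** [folklore] -/
theorem laplacian_tinyBlob_zero (a : ℝ) : (Δ (tinyBlob a)) 0 = 0 := by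
  have h1 : ContDiffAt ℝ 2 (fun z : EuclideanSpace ℝ (Fin 3) => blobF (sqn a z) • e₃) 0 :=
    (((contDiff_blobF.comp (contDiff_sqn a)).smul contDiff_const).of_le (by norm_cast)).contDiffAt
  have h2 : ContDiffAt ℝ 2 (fun z : EuclideanSpace ℝ (Fin 3) => blobCoef a z • z) 0 :=
    (((contDiff_blobCoef a).smul contDiff_id).of_le (by norm_cast)).contDiffAt
  have hfun : tinyBlob a = (fun z => blobF (sqn a z) • e₃) - fun z => blobCoef a z • z := rfl
  have hθ : ContDiff ℝ 2 (fun z : EuclideanSpace ℝ (Fin 3) => blobF (sqn a z)) :=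
    (contDiff_blobF.comp (contDiff_sqn a)).of_le (by norm_cast)
  rw [hfun, h1.laplacian_sub h2, laplacian_blobCoef_smul_zero,
    laplacian_smul_const (θ := fun z : EuclideanSpace ℝ (Fin 3) => blobF (sqn a z)) hθ e₃ 0,
    laplacian_blobF_sqn_zero a]
  simp

/-! ## §4 A point of nonzero strain -/

/-- **The blob has a nonzero Jacobian somewhere in `B̄(0, 2a)`** (`a > 0`): a constant field would have
`e₃ = B_a(0) = B_a(y) = 0` for `‖y‖ > 2a`; and outside `B̄(0, 2a)` the field vanishes identically, so
its Jacobian vanishes there. [folklore] -/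
theorem exists_fderiv_tinyBlob_ne_zero (ha : 0 < a) :
    ∃ y : EuclideanSpace ℝ (Fin 3), ‖y‖ ≤ 2 * a ∧ fderiv ℝ (tinyBlob a) y ≠ 0 := by
  by_contra hcon
  push Not at hcon
  -- then the Jacobian vanishes everywhere
  have hall : ∀ y, fderiv ℝ (tinyBlob a) y = 0 := by
    intro y
    by_cases hy : ‖y‖ ≤ 2 * a
    · exact hcon y hy
    · rw [not_le] at hy
      have hev : tinyBlob a =ᶠ[𝓝 y] fun _ => (0 : EuclideanSpace ℝ (Fin 3)) := by
        have hopen : IsOpen {z : EuclideanSpace ℝ (Fin 3) | 2 * a < ‖z‖} :=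
          isOpen_lt continuous_const continuous_norm
        filter_upwards [hopen.mem_nhds hy] with z hz
        exact tinyBlob_eq_zero_of_norm_gt ha hz
      rw [hev.fderiv_eq, fderiv_const_apply]
  -- so the blob is constant: `e₃ = B(0) = B(far point) = 0`
  set yfar : EuclideanSpace ℝ (Fin 3) := (3 * a) • e₃ with hyfar
  have hfar : 2 * a < ‖yfar‖ := by
    rw [hyfar, norm_smul, norm_e₃, mul_one, Real.norm_eq_abs, abs_of_pos (by positivity)]
    linarith
  have hconst := is_const_of_fderiv_eq_zero (differentiable_tinyBlob a) hall 0 yfar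
  rw [tinyBlob_zero, tinyBlob_eq_zero_of_norm_gt ha hfar] at hconst
  have : ‖(e₃ : EuclideanSpace ℝ (Fin 3))‖ = 0 := by rw [hconst, norm_zero]
  rw [norm_e₃] at this
  exact one_ne_zero this

end Summit.NavierStokesRegularity.FluidComputer.PalasekTowerClayBridge.TinyBlob

end
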